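import Summits.MatrixMultiplication.OmegaCensus.Z4Z4DominoSevenTables
import HarnessLib

/-!
# Gaussian-integer table for the domino cells with a part of size `9` over `A ↠ ℤ₄ × ℤ₄`

ω-census `pub-omega`, family (b3), seat pub-omega-group gen 16.  Framing: lottery ticket; floor = certified bounds/negative
ranges.  VALUE: the finite kernel computation behind `no_law_cube_19e_of_onto_z4z4` (`DominoPartNineZ4Z4.lean`); NOT
progress on ω.

For `|X| = 9` the pigeonhole gives THREE points `x₁, x₂, x₃` of `X` in one class mod `2`; after translating by `x₁` the real
characters force the other six points into the classes `P₁ = (m even, n odd)`, `P₂ = (m odd, n even)`, `P₃ = (m, n odd)` with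
sizes exactly `(2,2,2)` (`three_parts_sum`: the three classes are disjoint and cover), so there is a single shape.  The same
pair of characters as for `d = 7` — `w'` (`ψβ' = 1`, `ψγ = i`) and `w' + 2w` (`ψβ' = −1`, `ψγ = i`) — kills every exponent
configuration (exact enumeration, pub-omega-group-g16/code/z4z4_killsets.py and table9check.py): `table9` (`decide`, binders
interleaved with the parity hypotheses, `4 096` instances past them), endgame `finish9`.
-/

namespace Summit.MatrixMultiplication.OmegaCensus

open Finset

/-! ## The class-size count (finite sets) -/

/-- **Counting lemma.**  Three subsets `P₁, P₂, P₃` of a finite set `X` with `|X| ≥ 5`, each of size `≤ 2`, covering `X`, such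
that a point in two of them lies in the third: they are pairwise disjoint, partition `X`, and `|P₁| + |P₂| + |P₃| = |X|`.
[folklore] -/
theorem three_parts_sum {α : Type*} [DecidableEq α] (X P₁ P₂ P₃ : Finset α) (h₁ : P₁ ⊆ X) (h₂ : P₂ ⊆ X) (h₃ : P₃ ⊆ X)
    (hcov : ∀ y ∈ X, y ∈ P₁ ∨ y ∈ P₂ ∨ y ∈ P₃) (h12 : ∀ y ∈ X, y ∈ P₁ → y ∈ P₂ → y ∈ P₃)
    (h13 : ∀ y ∈ X, y ∈ P₁ → y ∈ P₃ → y ∈ P₂) (h23 : ∀ y ∈ X, y ∈ P₂ → y ∈ P₃ → y ∈ P₁) (hX : 5 ≤ X.card)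
    (hc₁ : P₁.card ≤ 2) (hc₂ : P₂.card ≤ 2) (hc₃ : P₃.card ≤ 2) :
    Disjoint P₁ P₂ ∧ Disjoint P₁ P₃ ∧ Disjoint P₂ P₃ ∧ P₁ ∪ P₂ ∪ P₃ = X ∧ P₁.card + P₂.card + P₃.card = X.card := by
  -- no point lies in two of the parts
  have key : ∀ y ∈ X, ¬ (y ∈ P₁ ∧ y ∈ P₂) := by
    rintro y hy ⟨hy₁, hy₂⟩
    have hy₃ := h12 y hy hy₁ hy₂
    have hsub : X.erase y ⊆ (P₁.erase y ∪ P₂.erase y) ∪ P₃.erase y := by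
      intro z hz
      obtain ⟨hzy, hzX⟩ := mem_erase.1 hz
      rcases hcov z hzX with hz' | hz' | hz'
      · exact mem_union_left _ (mem_union_left _ (mem_erase.2 ⟨hzy, hz'⟩))
      · exact mem_union_left _ (mem_union_right _ (mem_erase.2 ⟨hzy, hz'⟩))
      · exact mem_union_right _ (mem_erase.2 ⟨hzy, hz'⟩)
    have hle := card_le_card hsub
    have hu1 := card_union_le (P₁.erase y ∪ P₂.erase y) (P₃.erase y)
    have hu2 := card_union_le (P₁.erase y) (P₂.erase y)
    rw [card_erase_of_mem hy] at hle
    rw [card_erase_of_mem hy₁, card_erase_of_mem hy₂] at hu2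
    rw [card_erase_of_mem hy₃] at hu1
    omega
  have d12 : Disjoint P₁ P₂ := disjoint_left.2 fun a ha ha' => key a (h₁ ha) ⟨ha, ha'⟩
  have d13 : Disjoint P₁ P₃ := disjoint_left.2 fun a ha ha' => key a (h₁ ha) ⟨ha, h13 a (h₁ ha) ha ha'⟩
  have d23 : Disjoint P₂ P₃ := disjoint_left.2 fun a ha ha' => key a (h₂ ha) ⟨h23 a (h₂ ha) ha ha', ha⟩
  have hU : P₁ ∪ P₂ ∪ P₃ = X := by
    refine Subset.antisymm (union_subset (union_subset h₁ h₂) h₃) fun y hy => ?_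
    rcases hcov y hy with h | h | h
    · exact mem_union_left _ (mem_union_left _ h)
    · exact mem_union_left _ (mem_union_right _ h)
    · exact mem_union_right _ h
  have hsum : P₁.card + P₂.card + P₃.card = X.card := by
    rw [← hU, card_union_of_disjoint (disjoint_union_left.2 ⟨d13, d23⟩), card_union_of_disjoint d12]
  exact ⟨d12, d13, d23, hU, hsum⟩

/-! ## The two-character table for `d = 9` -/

set_option synthInstance.maxHeartbeats 400000 in
set_option synthInstance.maxSize 16384 in
/-- **Table (`d = 9`)** (`decide`; parity hypotheses interleaved with the binders, `4 096` instances past them).  Exponents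
`n` (coordinate `w'`) of `x₂, x₃` (`2n = 0`), of `y₄, y₅ ∈ P₁` (`n` odd, `m` even), `y₆, y₇ ∈ P₂` (`n` even, `m` odd),
`y₈, y₉ ∈ P₃` (`n`, `m` odd), and of `x₀ − x₁` (`l₁ = ⟨w,·⟩`, `l₂ = ⟨w',·⟩`): for the character `w'` (`ψβ' = 1`, `ψγ = i`) or
for `w' + 2w` (exponents `n + 2m`, `ψβ' = −1`, `ψγ = i`) the quantity `N` of `false_of_kill7p/m` is not divisible by `D`.
[folklore] -/
theorem table9 : ∀ n₂ : ZMod 4, 2 * n₂ = 0 → ∀ n₃ : ZMod 4, 2 * n₃ = 0 →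
    ∀ n₄ : ZMod 4, 2 * n₄ = 2 → ∀ n₅ : ZMod 4, 2 * n₅ = 2 → ∀ n₆ : ZMod 4, 2 * n₆ = 0 → ∀ n₇ : ZMod 4, 2 * n₇ = 0 → ∀ n₈ : ZMod 4, 2 * n₈ = 2 → ∀ n₉ : ZMod 4, 2 * n₉ = 2 → ∀ l₁ l₂ : ZMod 4,
    (((star (1 + (⟨0, 1⟩ : GaussianInt) ^ n₂.val + (⟨0, 1⟩ : GaussianInt) ^ n₃.val + (⟨0, 1⟩ : GaussianInt) ^ n₄.val + (⟨0, 1⟩ : GaussianInt) ^ n₅.val + (⟨0, 1⟩ : GaussianInt) ^ n₆.val + (⟨0, 1⟩ : GaussianInt) ^ n₇.val + (⟨0, 1⟩ : GaussianInt) ^ n₈.val + (⟨0, 1⟩ : GaussianInt) ^ n₉.val) + (1 + (⟨0, 1⟩ : GaussianInt) ^ n₂.val + (⟨0, 1⟩ : GaussianInt) ^ n₃.val + (⟨0, 1⟩ : GaussianInt) ^ n₄.val + (⟨0, 1⟩ : GaussianInt) ^ n₅.val + (⟨0, 1⟩ : GaussianInt) ^ n₆.val + (⟨0, 1⟩ :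 GaussianInt) ^ n₇.val + (⟨0, 1⟩ : GaussianInt) ^ n₈.val + (⟨0, 1⟩ : GaussianInt) ^ n₉.val)) * (-(⟨0, 1⟩ : GaussianInt) ^ l₂.val) -
        (⟨0, 1⟩ : GaussianInt) * (1 + (⟨0, 1⟩ : GaussianInt) ^ n₂.val + (⟨0, 1⟩ : GaussianInt) ^ n₃.val + (⟨0, 1⟩ : GaussianInt) ^ n₄.val + (⟨0, 1⟩ : GaussianInt) ^ n₅.val + (⟨0, 1⟩ : GaussianInt) ^ n₆.val + (⟨0, 1⟩ : GaussianInt) ^ n₇.val + (⟨0, 1⟩ : GaussianInt) ^ n₈.val + (⟨0, 1⟩ : GaussianInt) ^ n₉.val) * star (-(⟨0, 1⟩ : GaussianInt) ^ l₂.val)).re %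
      (3 * (1 + (⟨0, 1⟩ : GaussianInt) ^ n₂.val + (⟨0, 1⟩ : GaussianInt) ^ n₃.val + (⟨0, 1⟩ : GaussianInt) ^ n₄.val + (⟨0, 1⟩ : GaussianInt) ^ n₅.val + (⟨0, 1⟩ : GaussianInt) ^ n₆.val + (⟨0, 1⟩ : GaussianInt) ^ n₇.val + (⟨0, 1⟩ : GaussianInt) ^ n₈.val + (⟨0, 1⟩ : GaussianInt) ^ n₉.val).re *
          (1 + (⟨0, 1⟩ : GaussianInt) ^ n₂.val + (⟨0, 1⟩ : GaussianInt) ^ n₃.val + (⟨0, 1⟩ : GaussianInt) ^ n₄.val + (⟨0, 1⟩ : GaussianInt) ^ n₅.val + (⟨0, 1⟩ : GaussianInt) ^ n₆.val + (⟨0, 1⟩ : GaussianInt) ^ n₇.val + (⟨0, 1⟩ : GaussianInt) ^ n₈.val + (⟨0, 1⟩ : GaussianInt) ^ n₉.val).re -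
        (1 + (⟨0, 1⟩ : GaussianInt) ^ n₂.val + (⟨0, 1⟩ : GaussianInt) ^ n₃.val + (⟨0, 1⟩ : GaussianInt) ^ n₄.val + (⟨0, 1⟩ : GaussianInt) ^ n₅.val + (⟨0, 1⟩ : GaussianInt) ^ n₆.val + (⟨0, 1⟩ : GaussianInt) ^ n₇.val + (⟨0, 1⟩ : GaussianInt) ^ n₈.val + (⟨0, 1⟩ : GaussianInt) ^ n₉.val).im *
          (1 + (⟨0, 1⟩ : GaussianInt) ^ n₂.val + (⟨0, 1⟩ : GaussianInt) ^ n₃.val + (⟨0, 1⟩ : GaussianInt) ^ n₄.val + (⟨0, 1⟩ : GaussianInt) ^ n₅.val + (⟨0, 1⟩ : GaussianInt) ^ n₆.val + (⟨0, 1⟩ : GaussianInt) ^ n₇.val + (⟨0, 1⟩ : GaussianInt) ^ n₈.val + (⟨0, 1⟩ : GaussianInt) ^ n₉.val).im) ≠ 0 ∨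
     ((star (1 + (⟨0, 1⟩ : GaussianInt) ^ n₂.val + (⟨0, 1⟩ : GaussianInt) ^ n₃.val + (⟨0, 1⟩ : GaussianInt) ^ n₄.val + (⟨0, 1⟩ : GaussianInt) ^ n₅.val + (⟨0, 1⟩ : GaussianInt) ^ n₆.val + (⟨0, 1⟩ : GaussianInt) ^ n₇.val + (⟨0, 1⟩ : GaussianInt) ^ n₈.val + (⟨0, 1⟩ : GaussianInt) ^ n₉.val) + (1 + (⟨0, 1⟩ : GaussianInt) ^ n₂.val + (⟨0, 1⟩ : GaussianInt) ^ n₃.val + (⟨0, 1⟩ : GaussianInt) ^ n₄.val + (⟨0, 1⟩ : GaussianInt) ^ n₅.val + (⟨0, 1⟩ : GaussianInt) ^ n₆.val + (⟨0, 1⟩ : GaussianInt) ^ n₇.val + (⟨0, 1⟩ : GaussianInt) ^ n₈.val + (⟨0, 1⟩ : GaussianInt) ^ n₉.val)) * (-(⟨0, 1⟩ : GaussianInt) ^ l₂.val) -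
        (⟨0, 1⟩ : GaussianInt) * (1 + (⟨0, 1⟩ : GaussianInt) ^ n₂.val + (⟨0, 1⟩ : GaussianInt) ^ n₃.val + (⟨0, 1⟩ : GaussianInt) ^ n₄.val + (⟨0, 1⟩ : GaussianInt) ^ n₅.val + (⟨0, 1⟩ : GaussianInt) ^ n₆.val + (⟨0, 1⟩ : GaussianInt) ^ n₇.val + (⟨0, 1⟩ : GaussianInt) ^ n₈.val + (⟨0, 1⟩ : GaussianInt) ^ n₉.val) * star (-(⟨0, 1⟩ : GaussianInt) ^ l₂.val)).im %
      (3 * (1 + (⟨0, 1⟩ : GaussianInt) ^ n₂.val + (⟨0, 1⟩ : GaussianInt) ^ n₃.val + (⟨0, 1⟩ : GaussianInt) ^ n₄.val + (⟨0, 1⟩ : GaussianInt) ^ n₅.val + (⟨0, 1⟩ : GaussianInt) ^ n₆.val + (⟨0, 1⟩ : GaussianInt) ^ n₇.val + (⟨0, 1⟩ : GaussianInt) ^ n₈.val + (⟨0, 1⟩ : GaussianInt) ^ n₉.val).re *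
          (1 + (⟨0, 1⟩ : GaussianInt) ^ n₂.val + (⟨0, 1⟩ : GaussianInt) ^ n₃.val + (⟨0, 1⟩ : GaussianInt) ^ n₄.val + (⟨0, 1⟩ : GaussianInt) ^ n₅.val + (⟨0, 1⟩ : GaussianInt) ^ n₆.val + (⟨0, 1⟩ : GaussianInt) ^ n₇.val + (⟨0, 1⟩ : GaussianInt) ^ n₈.val + (⟨0, 1⟩ : GaussianInt) ^ n₉.val).re -
        (1 + (⟨0, 1⟩ : GaussianInt) ^ n₂.val + (⟨0, 1⟩ : GaussianInt) ^ n₃.val + (⟨0, 1⟩ : GaussianInt) ^ n₄.val + (⟨0, 1⟩ : GaussianInt) ^ n₅.val + (⟨0, 1⟩ : GaussianInt) ^ n₆.val + (⟨0, 1⟩ : GaussianInt) ^ n₇.val + (⟨0, 1⟩ : GaussianInt) ^ n₈.val + (⟨0, 1⟩ : GaussianInt) ^ n₉.val).im *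
          (1 + (⟨0, 1⟩ : GaussianInt) ^ n₂.val + (⟨0, 1⟩ : GaussianInt) ^ n₃.val + (⟨0, 1⟩ : GaussianInt) ^ n₄.val + (⟨0, 1⟩ : GaussianInt) ^ n₅.val + (⟨0, 1⟩ : GaussianInt) ^ n₆.val + (⟨0, 1⟩ : GaussianInt) ^ n₇.val + (⟨0, 1⟩ : GaussianInt) ^ n₈.val + (⟨0, 1⟩ : GaussianInt) ^ n₉.val).im) ≠ 0) ∨
    (((star (1 + (⟨0, 1⟩ : GaussianInt) ^ n₂.val + (⟨0, 1⟩ : GaussianInt) ^ n₃.val + (⟨0, 1⟩ : GaussianInt) ^ n₄.val + (⟨0, 1⟩ : GaussianInt) ^ n₅.val + (⟨0, 1⟩ : GaussianInt) ^ (n₆ + 2).val + (⟨0, 1⟩ : GaussianInt) ^ (n₇ + 2).val + (⟨0, 1⟩ : GaussianInt) ^ (n₈ + 2).val + (⟨0, 1⟩ : GaussianInt) ^ (n₉ + 2).val) - (1 + (⟨0, 1⟩ : GaussianInt) ^ n₂.val + (⟨0, 1⟩ : GaussianInt) ^ n₃.val + (⟨0, 1⟩ : GaussianInt) ^ n₄.val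 + (⟨0, 1⟩ : GaussianInt) ^ n₅.val + (⟨0, 1⟩ : GaussianInt) ^ (n₆ + 2).val + (⟨0, 1⟩ : GaussianInt) ^ (n₇ + 2).val + (⟨0, 1⟩ : GaussianInt) ^ (n₈ + 2).val + (⟨0, 1⟩ : GaussianInt) ^ (n₉ + 2).val)) * (-(⟨0, 1⟩ : GaussianInt) ^ (l₂ + 2 * l₁).val) -
        (⟨0, 1⟩ : GaussianInt) * (1 + (⟨0, 1⟩ : GaussianInt) ^ n₂.val + (⟨0, 1⟩ : GaussianInt) ^ n₃.val + (⟨0, 1⟩ : GaussianInt) ^ n₄.val + (⟨0, 1⟩ : GaussianInt) ^ n₅.val + (⟨0, 1⟩ : GaussianInt) ^ (n₆ + 2).val + (⟨0, 1⟩ : GaussianInt) ^ (n₇ + 2).val + (⟨0, 1⟩ : GaussianInt) ^ (n₈ + 2).val + (⟨0, 1⟩ : GaussianInt) ^ (n₉ + 2).val) * star (-(⟨0, 1⟩ : GaussianInt) ^ (l₂ + 2 * l₁).val)).re %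
      (3 * (1 + (⟨0, 1⟩ : GaussianInt) ^ n₂.val + (⟨0, 1⟩ : GaussianInt) ^ n₃.val + (⟨0, 1⟩ : GaussianInt) ^ n₄.val + (⟨0, 1⟩ : GaussianInt) ^ n₅.val + (⟨0, 1⟩ : GaussianInt) ^ (n₆ + 2).val + (⟨0, 1⟩ : GaussianInt) ^ (n₇ + 2).val + (⟨0, 1⟩ : GaussianInt) ^ (n₈ + 2).val + (⟨0, 1⟩ : GaussianInt) ^ (n₉ + 2).val).im *
          (1 + (⟨0, 1⟩ : GaussianInt) ^ n₂.val + (⟨0, 1⟩ : GaussianInt) ^ n₃.val + (⟨0, 1⟩ : GaussianInt) ^ n₄.val + (⟨0, 1⟩ : GaussianInt) ^ n₅.val + (⟨0, 1⟩ : GaussianInt) ^ (n₆ + 2).val + (⟨0, 1⟩ : GaussianInt) ^ (n₇ + 2).val + (⟨0, 1⟩ : GaussianInt) ^ (n₈ + 2).val + (⟨0, 1⟩ : GaussianInt) ^ (n₉ + 2).val).im -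
        (1 + (⟨0, 1⟩ : GaussianInt) ^ n₂.val + (⟨0, 1⟩ : GaussianInt) ^ n₃.val + (⟨0, 1⟩ : GaussianInt) ^ n₄.val + (⟨0, 1⟩ : GaussianInt) ^ n₅.val + (⟨0, 1⟩ : GaussianInt) ^ (n₆ + 2).val + (⟨0, 1⟩ : GaussianInt) ^ (n₇ + 2).val + (⟨0, 1⟩ : GaussianInt) ^ (n₈ + 2).val + (⟨0, 1⟩ : GaussianInt) ^ (n₉ + 2).val).re *
          (1 + (⟨0, 1⟩ : GaussianInt) ^ n₂.val + (⟨0, 1⟩ : GaussianInt) ^ n₃.val + (⟨0, 1⟩ : GaussianInt) ^ n₄.val + (⟨0, 1⟩ : GaussianInt) ^ n₅.val + (⟨0, 1⟩ : GaussianInt) ^ (n₆ + 2).val + (⟨0, 1⟩ : GaussianInt) ^ (n₇ + 2).val + (⟨0, 1⟩ : GaussianInt) ^ (n₈ + 2).val + (⟨0, 1⟩ : GaussianInt) ^ (n₉ + 2).val).re) ≠ 0 ∨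
     ((star (1 + (⟨0, 1⟩ : GaussianInt) ^ n₂.val + (⟨0, 1⟩ : GaussianInt) ^ n₃.val + (⟨0, 1⟩ : GaussianInt) ^ n₄.val + (⟨0, 1⟩ : GaussianInt) ^ n₅.val + (⟨0, 1⟩ : GaussianInt) ^ (n₆ + 2).val + (⟨0, 1⟩ : GaussianInt) ^ (n₇ + 2).val + (⟨0, 1⟩ : GaussianInt) ^ (n₈ + 2).val + (⟨0, 1⟩ : GaussianInt) ^ (n₉ + 2).val) - (1 + (⟨0, 1⟩ : GaussianInt) ^ n₂.val + (⟨0, 1⟩ : GaussianInt) ^ n₃.val + (⟨0, 1⟩ : GaussianInt) ^ n₄.val + (⟨0, 1⟩ : GaussianInt) ^ n₅.val + (⟨0, 1⟩ : GaussianInt) ^ (n₆ + 2).val + (⟨0, 1⟩ : GaussianInt) ^ (n₇ + 2).val + (⟨0, 1⟩ : GaussianInt) ^ (n₈ + 2).val + (⟨0, 1⟩ : GaussianInt) ^ (n₉ + 2).val)) * (-(⟨0, 1⟩ : GaussianInt) ^ (l₂ + 2 * l₁).val) -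
        (⟨0, 1⟩ : GaussianInt) * (1 + (⟨0, 1⟩ : GaussianInt) ^ n₂.val + (⟨0, 1⟩ : GaussianInt) ^ n₃.val + (⟨0, 1⟩ : GaussianInt) ^ n₄.val + (⟨0, 1⟩ : GaussianInt) ^ n₅.val + (⟨0, 1⟩ : GaussianInt) ^ (n₆ + 2).val + (⟨0, 1⟩ : GaussianInt) ^ (n₇ + 2).val + (⟨0, 1⟩ : GaussianInt) ^ (n₈ + 2).val + (⟨0, 1⟩ : GaussianInt) ^ (n₉ + 2).val) * star (-(⟨0, 1⟩ : GaussianInt) ^ (l₂ + 2 * l₁).val)).im %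
      (3 * (1 + (⟨0, 1⟩ : GaussianInt) ^ n₂.val + (⟨0, 1⟩ : GaussianInt) ^ n₃.val + (⟨0, 1⟩ : GaussianInt) ^ n₄.val + (⟨0, 1⟩ : GaussianInt) ^ n₅.val + (⟨0, 1⟩ : GaussianInt) ^ (n₆ + 2).val + (⟨0, 1⟩ : GaussianInt) ^ (n₇ + 2).val + (⟨0, 1⟩ : GaussianInt) ^ (n₈ + 2).val + (⟨0, 1⟩ : GaussianInt) ^ (n₉ + 2).val).im *
          (1 + (⟨0, 1⟩ : GaussianInt) ^ n₂.val + (⟨0, 1⟩ : GaussianInt) ^ n₃.val + (⟨0, 1⟩ : GaussianInt) ^ n₄.val + (⟨0, 1⟩ : GaussianInt) ^ n₅.val + (⟨0, 1⟩ : GaussianInt) ^ (n₆ + 2).val + (⟨0, 1⟩ : GaussianInt) ^ (n₇ + 2).val + (⟨0, 1⟩ : GaussianInt) ^ (n₈ + 2).val + (⟨0, 1⟩ : GaussianInt) ^ (n₉ + 2).val).im -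
        (1 + (⟨0, 1⟩ : GaussianInt) ^ n₂.val + (⟨0, 1⟩ : GaussianInt) ^ n₃.val + (⟨0, 1⟩ : GaussianInt) ^ n₄.val + (⟨0, 1⟩ : GaussianInt) ^ n₅.val + (⟨0, 1⟩ : GaussianInt) ^ (n₆ + 2).val + (⟨0, 1⟩ : GaussianInt) ^ (n₇ + 2).val + (⟨0, 1⟩ : GaussianInt) ^ (n₈ + 2).val + (⟨0, 1⟩ : GaussianInt) ^ (n₉ + 2).val).re *
          (1 + (⟨0, 1⟩ : GaussianInt) ^ n₂.val + (⟨0, 1⟩ : GaussianInt) ^ n₃.val + (⟨0, 1⟩ : GaussianInt) ^ n₄.val + (⟨0, 1⟩ : GaussianInt) ^ n₅.val + (⟨0, 1⟩ : GaussianInt) ^ (n₆ + 2).val + (⟨0, 1⟩ : GaussianInt) ^ (n₇ + 2).val + (⟨0, 1⟩ : GaussianInt) ^ (n₈ + 2).val + (⟨0, 1⟩ : GaussianInt) ^ (n₉ + 2).val).re) ≠ 0) := by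
  decide +kernel

/-! ## The endgame -/

/-- **Endgame (`d = 9`).**  Exponent data `(m, n)` of `x₂, x₃, y₄, …, y₉` relative to `x₁` in the coordinates `w, w'`, with
`2m₂ = 2n₂ = 2m₃ = 2n₃ = 0`, `y₄, y₅ ∈ P₁`, `y₆, y₇ ∈ P₂`, `y₈, y₉ ∈ P₃`, and the two identities for the characters `w'` and
`w' + 2w`: contradiction (`table9` + `false_of_kill7p/m`). [folklore] -/
theorem finish9 (n₂ n₃ n₄ n₅ n₆ n₇ n₈ n₉ m₂ m₃ m₄ m₅ m₆ m₇ m₈ m₉ l₁ l₂ : ZMod 4) (a₁ a₂ b₁ b₂ : GaussianInt)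
    (h2m₂ : 2 * m₂ = 0) (h2n₂ : 2 * n₂ = 0) (h2m₃ : 2 * m₃ = 0) (h2n₃ : 2 * n₃ = 0)
    (h4 : 2 * m₄ = 0 ∧ 2 * n₄ = 2) (h5 : 2 * m₅ = 0 ∧ 2 * n₅ = 2) (h6 : 2 * m₆ = 2 ∧ 2 * n₆ = 0)
    (h7 : 2 * m₇ = 2 ∧ 2 * n₇ = 0) (h8 : 2 * m₈ = 2 ∧ 2 * n₈ = 2) (h9 : 2 * m₉ = 2 ∧ 2 * n₉ = 2)
    (ha₁ : a₁ = 1 + (⟨0, 1⟩ : GaussianInt) ^ n₂.val + (⟨0, 1⟩ : GaussianInt) ^ n₃.val + (⟨0, 1⟩ : GaussianInt) ^ n₄.val + (⟨0, 1⟩ : GaussianInt) ^ n₅.val + (⟨0, 1⟩ : GaussianInt) ^ n₆.val + (⟨0, 1⟩ : GaussianInt) ^ n₇.val + (⟨0, 1⟩ : GaussianInt) ^ n₈.val + (⟨0, 1⟩ : GaussianInt) ^ n₉.val)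
    (ha₂ : a₂ = 1 + (⟨0, 1⟩ : GaussianInt) ^ (n₂ + 2 * m₂).val + (⟨0, 1⟩ : GaussianInt) ^ (n₃ + 2 * m₃).val + (⟨0, 1⟩ : GaussianInt) ^ (n₄ + 2 * m₄).val + (⟨0, 1⟩ : GaussianInt) ^ (n₅ + 2 * m₅).val + (⟨0, 1⟩ : GaussianInt) ^ (n₆ + 2 * m₆).val + (⟨0, 1⟩ : GaussianInt) ^ (n₇ + 2 * m₇).val + (⟨0, 1⟩ : GaussianInt) ^ (n₈ + 2 * m₈).val + (⟨0, 1⟩ : GaussianInt) ^ (n₉ + 2 * m₉).val)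
    (E1 : a₁ * b₁ + 1 * star a₁ * b₁ + (⟨0, 1⟩ : GaussianInt) * a₁ * star b₁ = -(⟨0, 1⟩ : GaussianInt) ^ l₂.val)
    (E2 : a₂ * b₂ + (-1) * star a₂ * b₂ + (⟨0, 1⟩ : GaussianInt) * a₂ * star b₂ = -(⟨0, 1⟩ : GaussianInt) ^ (l₂ + 2 * l₁).val) :
    False := by
  subst ha₁ ha₂
  rw [ipow_add_two_mul_of_eq_zero _ _ h2m₂, ipow_add_two_mul_of_eq_zero _ _ h2m₃, ipow_add_two_mul_of_eq_zero _ _ h4.1, ipow_add_two_mul_of_eq_zero _ _ h5.1, ipow_add_two_mul_of_eq_two _ _ h6.1, ipow_add_two_mul_of_eq_two _ _ h7.1, ipow_add_two_mul_of_eq_two _ _ h8.1, ipow_add_two_mul_of_eq_two _ _ h9.1] at E2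
  rcases table9 n₂ h2n₂ n₃ h2n₃ n₄ h4.2 n₅ h5.2 n₆ h6.2 n₇ h7.2 n₈ h8.2 n₉ h9.2 l₁ l₂ with hk | hk
  · exact false_of_kill7p E1 hk
  · exact false_of_kill7m E2 hk

end Summit.MatrixMultiplication.OmegaCensus
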